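import Mathlib
import HarnessLib
import Literature.Analysis.FluidPDE.AxisymmetricEuler
import Literature.Analysis.FluidPDE.SwirlTransportProofs
import Literature.Analysis.FluidPDE.ClassicalSolution
import Literature.Analysis.FluidPDE.SelfSimilar
import Literature.Analysis.FluidPDE.LocalTypeI
import Literature.Analysis.FluidPDE.VectorCalculus
import Literature.Analysis.FluidPDE.VorticityCalculus
import Literature.Analysis.FluidPDE.TaoEnstrophyLocalisation
import Literature.Analysis.FluidPDE.LagrangianTimeDerivativeTools
import Literature.Analysis.FluidPDE.LerayProfileCalculus
import Literature.Analysis.FluidPDE.WholeSpaceIBP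
import Literature.Analysis.FluidPDE.TypeIAncientMild
import Literature.Analysis.FluidPDE.TypeIAncientMildClassical
import Literature.Analysis.UnboundedOperators.HeatKernel
import Summits.NavierStokesRegularity.NavierStokesRegularity.Theorems.LocalSineTubeDoorProfileAlignedWindowRigidityAncient
import Summits.NavierStokesRegularity.NavierStokesRegularity.Theorems.PoloidalWindowDoorPoloidalWindowRigidityWindow
import Summits.NavierStokesRegularity.NavierStokesRegularity.Theorems.PoloidalWindowDoorPoloidalWindowRigidityFlat
import Summits.NavierStokesRegularity.NavierStokesRegularity.Theorems.PoloidalWindowDoorPoloidalWindowRigidityDegenerate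
import Summits.NavierStokesRegularity.NavierStokesRegularity.Theorems.PoloidalWindowDoorPoloidalWindowRigidityScrew
import Summits.NavierStokesRegularity.NavierStokesRegularity.Theorems.PoloidalWindowDoorPoloidalWindowRigidityClassRate

/-!
# Route `PoloidalWindowDoor`, crux `PoloidalWindowRigidity` (K2, stmt-NavierStokesRegularity-19708), line
# `slicesharp-screw` — GLUE for stub S1 `stub_screwStratum`: the screw-symmetric stratum ASSEMBLED from the
# registered support stubs L2 / L3 / L4 (taken as hypotheses in their registered shape)

Cell ns-regularity-ideate, seat ns-poloidal-K2-p3 (stub-worker; `--supports` the crux, `--as helper`).  The K2 lead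
(nsreg-p7 g3) registered the reshaped skeleton `slicesharp-screw` on the crux item: the slice-sharpened residue is
split along the SCREW-SYMMETRIC stratum, whose emptiness `stub_screwStratum` (S1, CENSUS-K2G §12 Cor. B) is to be
assembled from three support stubs — L2 `stub_screwKinematics` (Lipschitz bound of the screw component from a
vorticity bound), L3 `stub_screwPressure` (the screw component of `∇p` is spatially constant along a screw-invariant
classical flow), L4 `stub_decayingSlopeLiouville` (ancient decaying-slope Liouville theorem for transported–diffused
scalars with a time-only source) — together with the tree files `…Screw` (transport law of the screw component,
p448482), `…ClassRate` (vorticity rate `C₂/(−t)` on the class, p450704) and `…Degenerate.eq_zero_of_irrotational`.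

This file and its companion supply every remaining piece of that assembly, MODULO the three stubs; here:

* `fderiv_apply_screwField` — infinitesimal screw invariance: `Du(y)[h(y)] = κ J u(y)` for `h = e₃ + κ J(· − c)`;
* `fderiv_screwComponent` — the kinematic identity `D⟪u,h⟫(y)[w] = ⟪w × h(y), curl u(y)⟫` (i.e. `∇(u·h) = h × ω`);
* `curl_eq_zero_of_screwComponent_const` — for a POLOIDAL screw-invariant field, `u·h` constant ⇒ `curl u ≡ 0`;
* `screwComponent_transport_centre` — p448482's transport law `(∂ₜ + u·∇ − νΔ)(u·h) = −h·∇p − 2νκ ω₃` for the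
  screw field about a GENERAL vertical axis `c` (p448482 is `c = 0`);
* `contDiffOn_screwComponent` — `θ(t,y) = ⟪v t y, h y⟫` is jointly `C²` on the open slab (L4's regularity input);
and the companion file `…ScrewAssembly` (this seat) finishes: L4's pointwise equation for `θ` with the intrinsic
time-only source from L3, L4's slope hypothesis `ε(t) = C₂/(−t)` from L2 and `…ClassRate`, and
`screwStratum_of_L2_L3_L4` = S1 verbatim from the registered signatures of L2, L3, L4.

WHAT THIS IS NOT: not a claim about Navier–Stokes regularity and not the open residue S2 — kernel-checked glue for
one stratum of a door route's crux (bears_on LADDER-NS N0, rung N0-LocalTubeDoorPoloidal).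
-/

noncomputable section

-- the summit and its single sub-problem share the name (CONVENTIONS §1), as in every Theorems file
set_option linter.dupNamespace false

namespace Summit.NavierStokesRegularity.NavierStokesRegularity.Theorems.PoloidalWindowDoorPoloidalWindowRigidityScrewGlue

open MeasureTheory Set Function Filter Topology TopologicalSpace Metric InnerProductSpace
open scoped RealInnerProductSpace InnerProductSpace Laplacian ContDiff
open Literature.Analysis Literature.Analysis.FluidPDE
open Summit.NavierStokesRegularity.NavierStokesRegularity.Theorems.LocalSineTubeDoorProfileAlignedWindowRigidityAncient
open Summit.NavierStokesRegularity.NavierStokesRegularity.Theorems.PoloidalWindowDoorPoloidalWindowRigidityWindow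
open Summit.NavierStokesRegularity.NavierStokesRegularity.Theorems.PoloidalWindowDoorPoloidalWindowRigidityFlat
open Summit.NavierStokesRegularity.NavierStokesRegularity.Theorems.PoloidalWindowDoorPoloidalWindowRigidityDegenerate
open Summit.NavierStokesRegularity.NavierStokesRegularity.Theorems.PoloidalWindowDoorPoloidalWindowRigidityScrew
open Summit.NavierStokesRegularity.NavierStokesRegularity.Theorems.PoloidalWindowDoorPoloidalWindowRigidityClassRate

/-! ### The screw Killing field about the vertical axis through `c` -/

/-- The screw Killing field about the vertical axis through `c` with pitch parameter `κ`: `h(y) = e₃ + κ J (y − c)`. -/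
theorem hasFDerivAt_screwField_centre (κ : ℝ) (c y : EuclideanSpace ℝ (Fin 3)) :
    HasFDerivAt (fun y : EuclideanSpace ℝ (Fin 3) =>
        (EuclideanSpace.single 2 (1 : ℝ) : EuclideanSpace ℝ (Fin 3)) + κ • rotGen (y - c)) (κ • rotGenL) y := by
  have h1 : HasFDerivAt (fun y : EuclideanSpace ℝ (Fin 3) => rotGen (y - c)) rotGenL y := by
    have e : (fun y : EuclideanSpace ℝ (Fin 3) => rotGen (y - c)) = fun y => rotGen y - rotGen c := by
      funext y; exact map_sub rotGenL y c
    rw [e]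
    exact (hasFDerivAt_rotGen y).sub_const _
  exact (h1.const_smul κ).const_add _

/-- The screw field about the axis through `c` is smooth. -/
theorem contDiff_screwField_centre (κ : ℝ) (c : EuclideanSpace ℝ (Fin 3)) {n : WithTop ℕ∞} :
    ContDiff ℝ n (fun y : EuclideanSpace ℝ (Fin 3) =>
      (EuclideanSpace.single 2 (1 : ℝ) : EuclideanSpace ℝ (Fin 3)) + κ • rotGen (y - c)) :=
  contDiff_const.add ((contDiff_rotGen.comp (contDiff_id.sub contDiff_const)).const_smul κ)

/-- `Δh = 0` for the screw field about the axis through `c` (it is affine). -/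
theorem laplacian_screwField_centre (κ : ℝ) (c x : EuclideanSpace ℝ (Fin 3)) :
    (Δ fun y : EuclideanSpace ℝ (Fin 3) =>
      (EuclideanSpace.single 2 (1 : ℝ) : EuclideanSpace ℝ (Fin 3)) + κ • rotGen (y - c)) x = 0 := by
  rw [laplacian_eq_sum_fderiv_fderiv (EuclideanSpace.basisFun (Fin 3) ℝ) (contDiff_screwField_centre κ c) x]
  refine Finset.sum_eq_zero fun i _ => ?_
  have h : (fun y : EuclideanSpace ℝ (Fin 3) =>
      fderiv ℝ (fun y : EuclideanSpace ℝ (Fin 3) =>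
        (EuclideanSpace.single 2 (1 : ℝ) : EuclideanSpace ℝ (Fin 3)) + κ • rotGen (y - c)) y
        (EuclideanSpace.basisFun (Fin 3) ℝ i)) =
      fun _ => (κ • rotGenL) (EuclideanSpace.basisFun (Fin 3) ℝ i) := by
    funext y; rw [(hasFDerivAt_screwField_centre κ c y).fderiv]
  rw [h, fderiv_fun_const, Pi.zero_apply]
  rfl

/-- At the axis point the screw field is `e₃`: `h(c) = e₃`. -/
theorem screwField_centre_self (κ : ℝ) (c : EuclideanSpace ℝ (Fin 3)) :
    (EuclideanSpace.single 2 (1 : ℝ) : EuclideanSpace ℝ (Fin 3)) + κ • rotGen (c - c) =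
      EuclideanSpace.single 2 (1 : ℝ) := by
  rw [sub_self, show rotGen (0 : EuclideanSpace ℝ (Fin 3)) = 0 from map_zero rotGenL, smul_zero, add_zero]

/-! ### Kinematics of screw-invariant fields -/

variable {κ : ℝ} {c : EuclideanSpace ℝ (Fin 3)}

/-- **Infinitesimal screw invariance.** If `u ∈ C¹` satisfies `u(c + R_{κa}(y − c) + a e₃) = R_{κa} u(y)` for all
`a`, `y`, then differentiating at `a = 0`: `Du(y)[e₃ + κ J(y − c)] = κ J u(y)`. -/
theorem fderiv_apply_screwField {u : EuclideanSpace ℝ (Fin 3) → EuclideanSpace ℝ (Fin 3)} (hu : ContDiff ℝ 1 u)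
    (hinv : ∀ (a : ℝ) (y : EuclideanSpace ℝ (Fin 3)),
      u (c + rotZ (κ * a) (y - c) + a • EuclideanSpace.single 2 (1 : ℝ)) = rotZ (κ * a) (u y))
    (y : EuclideanSpace ℝ (Fin 3)) :
    fderiv ℝ u y ((EuclideanSpace.single 2 (1 : ℝ) : EuclideanSpace ℝ (Fin 3)) + κ • rotGen (y - c)) =
      κ • rotGen (u y) := by
  -- the orbit `a ↦ S_a y` and its velocity at `a = 0`
  have hκ : HasDerivAt (fun a : ℝ => κ * a) κ 0 := by simpa using (hasDerivAt_id (0 : ℝ)).const_mul κ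
  have horb : HasDerivAt (fun a : ℝ => c + rotZ (κ * a) (y - c) + a • (EuclideanSpace.single 2 (1 : ℝ) : EuclideanSpace ℝ (Fin 3)))
      (κ • rotGen (y - c) + (EuclideanSpace.single 2 (1 : ℝ) : EuclideanSpace ℝ (Fin 3))) 0 := by
    have h2 : HasDerivAt (fun θ => rotZ θ (y - c)) (rotGen (y - c)) (κ * 0) := by
      rw [mul_zero]; exact hasDerivAt_rotZ_zero (y - c)
    have h3 : HasDerivAt (fun a : ℝ => rotZ (κ * a) (y - c)) (κ • rotGen (y - c)) 0 := h2.scomp 0 hκ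
    have h4 : HasDerivAt (fun a : ℝ => a • (EuclideanSpace.single 2 (1 : ℝ) : EuclideanSpace ℝ (Fin 3)))
        ((1 : ℝ) • (EuclideanSpace.single 2 (1 : ℝ) : EuclideanSpace ℝ (Fin 3))) 0 :=
      (hasDerivAt_id (0 : ℝ)).smul_const _
    rw [one_smul] at h4
    exact (h3.const_add c).add h4
  have h0 : c + rotZ (κ * 0) (y - c) + (0 : ℝ) • (EuclideanSpace.single 2 (1 : ℝ) : EuclideanSpace ℝ (Fin 3)) = y := by
    rw [mul_zero, rotZ_zero, zero_smul, add_zero, add_sub_cancel]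
  -- left side: chain rule
  have hL : HasDerivAt (fun a : ℝ => u (c + rotZ (κ * a) (y - c) + a • (EuclideanSpace.single 2 (1 : ℝ) : EuclideanSpace ℝ (Fin 3))))
      (fderiv ℝ u y (κ • rotGen (y - c) + (EuclideanSpace.single 2 (1 : ℝ) : EuclideanSpace ℝ (Fin 3)))) 0 := by
    have hu' : HasFDerivAt u (fderiv ℝ u y)
        (c + rotZ (κ * 0) (y - c) + (0 : ℝ) • (EuclideanSpace.single 2 (1 : ℝ) : EuclideanSpace ℝ (Fin 3))) := by
      rw [h0]; exact ((hu.differentiable one_ne_zero) y).hasFDerivAt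
    exact hu'.comp_hasDerivAt (0 : ℝ) horb
  -- right side
  have hR : HasDerivAt (fun a : ℝ => rotZ (κ * a) (u y)) (κ • rotGen (u y)) 0 := by
    have h2 : HasDerivAt (fun θ => rotZ θ (u y)) (rotGen (u y)) (κ * 0) := by
      rw [mul_zero]; exact hasDerivAt_rotZ_zero (u y)
    exact h2.scomp 0 hκ
  have heq : (fun a : ℝ => u (c + rotZ (κ * a) (y - c) + a • (EuclideanSpace.single 2 (1 : ℝ) : EuclideanSpace ℝ (Fin 3)))) =
      fun a : ℝ => rotZ (κ * a) (u y) := funext fun a => hinv a y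
  rw [heq] at hL
  rw [add_comm, ← hL.unique hR]

/-- `⟪v, J w⟫ = −⟪J v, w⟫`: the rotation generator is skew. -/
theorem inner_rotGen_right_eq_neg (v w : EuclideanSpace ℝ (Fin 3)) : ⟪v, rotGen w⟫_ℝ = -⟪rotGen v, w⟫_ℝ := by
  rw [real_inner_comm, inner_rotGen_left, inner_rotGen_left]; ring

/-- **The kinematic identity `∇(u·h) = h × ω`.** For a `C¹` field `u` invariant under the screw motions of pitch `κ`
about the vertical axis through `c` and `θ(y) = ⟪u(y), h(y)⟫`, `h = e₃ + κ J(· − c)`: for every direction `w`,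
`Dθ(y)[w] = ⟪w × h(y), curl u(y)⟫` (Leibniz: `Dθ[w] = ⟪Du w, h⟫ + κ⟪u, Jw⟫ = ⟪Du w, h⟫ − ⟪Du h, w⟫` by infinitesimal
invariance and skewness of `J`, and `⟪Du w, h⟫ − ⟪Du h, w⟫ = ⟪w × h, curl u⟫`). -/
theorem fderiv_screwComponent {u : EuclideanSpace ℝ (Fin 3) → EuclideanSpace ℝ (Fin 3)} (hu : ContDiff ℝ 1 u)
    (hinv : ∀ (a : ℝ) (y : EuclideanSpace ℝ (Fin 3)),
      u (c + rotZ (κ * a) (y - c) + a • EuclideanSpace.single 2 (1 : ℝ)) = rotZ (κ * a) (u y))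
    (y w : EuclideanSpace ℝ (Fin 3)) :
    fderiv ℝ (fun z => ⟪u z, (EuclideanSpace.single 2 (1 : ℝ) : EuclideanSpace ℝ (Fin 3)) + κ • rotGen (z - c)⟫_ℝ) y w =
      ⟪cross w ((EuclideanSpace.single 2 (1 : ℝ) : EuclideanSpace ℝ (Fin 3)) + κ • rotGen (y - c)), curl u y⟫_ℝ := by
  have hud : DifferentiableAt ℝ u y := (hu.differentiable one_ne_zero) y
  have hhd : DifferentiableAt ℝ (fun z : EuclideanSpace ℝ (Fin 3) =>
      (EuclideanSpace.single 2 (1 : ℝ) : EuclideanSpace ℝ (Fin 3)) + κ • rotGen (z - c)) y :=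
    (hasFDerivAt_screwField_centre κ c y).differentiableAt
  rw [fderiv_inner_apply ℝ hud hhd w, (hasFDerivAt_screwField_centre κ c y).fderiv, inner_cross_curl,
    fderiv_apply_screwField hu hinv y]
  simp only [FunLike.coe_smul, Pi.smul_apply, rotGenL_apply, inner_smul_right,
    inner_rotGen_right_eq_neg (u y) w, real_inner_comm (fderiv ℝ u y w), real_inner_comm (rotGen (u y)) w]
  ring

/-- **A poloidal screw-invariant field with constant screw component is irrotational.** If `u ∈ C¹`, `(curl u)₂ ≡ 0`,
`u` is invariant under the screw motions of pitch `κ` about the vertical axis through `c`, and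
`⟪u(y), h(y)⟫ = ⟪u(c), e₃⟫` for all `y`, then `curl u ≡ 0` (`∇θ = h × ω = (−ω₁, ω₀, ⋯)` vanishes). -/
theorem curl_eq_zero_of_screwComponent_const {u : EuclideanSpace ℝ (Fin 3) → EuclideanSpace ℝ (Fin 3)}
    (hu : ContDiff ℝ 1 u) (hpol : ∀ y, curl u y 2 = 0)
    (hinv : ∀ (a : ℝ) (y : EuclideanSpace ℝ (Fin 3)),
      u (c + rotZ (κ * a) (y - c) + a • EuclideanSpace.single 2 (1 : ℝ)) = rotZ (κ * a) (u y))
    (hconst : ∀ y, ⟪u y, (EuclideanSpace.single 2 (1 : ℝ) : EuclideanSpace ℝ (Fin 3)) + κ • rotGen (y - c)⟫_ℝ =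
      ⟪u c, (EuclideanSpace.single 2 (1 : ℝ) : EuclideanSpace ℝ (Fin 3))⟫_ℝ) :
    ∀ y, curl u y = 0 := by
  intro y
  have hD : ∀ w, ⟪cross w ((EuclideanSpace.single 2 (1 : ℝ) : EuclideanSpace ℝ (Fin 3)) + κ • rotGen (y - c)),
      curl u y⟫_ℝ = 0 := fun w => by
    rw [← fderiv_screwComponent hu hinv y w]
    have e : (fun z => ⟪u z, (EuclideanSpace.single 2 (1 : ℝ) : EuclideanSpace ℝ (Fin 3)) + κ • rotGen (z - c)⟫_ℝ) =
        fun _ => ⟪u c, (EuclideanSpace.single 2 (1 : ℝ) : EuclideanSpace ℝ (Fin 3))⟫_ℝ := funext hconst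
    rw [e, fderiv_fun_const]
    simp
  have h0 := hD (EuclideanSpace.single 0 1)
  have h1 := hD (EuclideanSpace.single 1 1)
  have h2 := hpol y
  simp only [cross, cross_apply, PiLp.inner_apply, RCLike.inner_apply, conj_trivial, Fin.sum_univ_three] at h0 h1
  simp [rotGen, h2] at h0 h1
  ext i
  fin_cases i
  · simpa using h1
  · simpa using h0
  · simpa using h2


/-! ### The transport law of the screw component about a general vertical axis (p448482 for `c = 0`) -/

/-- **THE SCREW-COMPONENT TRANSPORT LAW about the vertical axis through `c`.**  For a classical Navier–Stokes flow
`(u,p)` (viscosity `ν`, zero force) on an open time set `S`, the Killing field `h(y) = e₃ + κ J (y − c)`, `t ∈ S`, `x`: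
`∂ₜ(u·h) + (u·∇)(u·h) − νΔ(u·h) = −⟪∇p, h⟫ − 2νκ (curl u)₂` (port of `…Screw.screwComponent_transport`, which is the
case `c = 0`; the proof is the same: `Dh = κJ`, `Δh = 0`, `⟪u,(u·∇)h⟫ = κ⟪u,Ju⟫ = 0`, `Σᵢ⟪∂ᵢu,∂ᵢh⟫ = κ ω₃`). -/
theorem screwComponent_transport_centre (κ : ℝ) (c : EuclideanSpace ℝ (Fin 3)) {S : Set ℝ} (hSo : IsOpen S) {ν : ℝ}
    {u : ℝ → EuclideanSpace ℝ (Fin 3) → EuclideanSpace ℝ (Fin 3)} {p : ℝ → EuclideanSpace ℝ (Fin 3) → ℝ}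
    (hns : IsClassicalNSSolutionOn S ν 0 u p) {h : EuclideanSpace ℝ (Fin 3) → EuclideanSpace ℝ (Fin 3)}
    (hh : ∀ y, h y = (EuclideanSpace.single 2 (1 : ℝ) : EuclideanSpace ℝ (Fin 3)) + κ • rotGen (y - c)) {t : ℝ}
    (ht : t ∈ S) (x : EuclideanSpace ℝ (Fin 3)) :
    derivWithin (fun τ => ⟪u τ x, h x⟫_ℝ) S t
        + fderiv ℝ (fun y => ⟪u t y, h y⟫_ℝ) x (u t x)
        - ν * (Δ (fun y => ⟪u t y, h y⟫_ℝ)) x =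
      -⟪gradient (p t) x, h x⟫_ℝ - 2 * ν * κ * curl (u t) x 2 := by
  have hS : UniqueDiffOn ℝ S := hSo.uniqueDiffOn
  have hfun : h = fun y => (EuclideanSpace.single 2 (1 : ℝ) : EuclideanSpace ℝ (Fin 3)) + κ • rotGen (y - c) :=
    funext hh
  -- ## smoothness of the slice and of the screw field
  have hU2 : ContDiff ℝ 2 (u t) := contDiff_infty.1 (hns.contDiff_velocity ht) 2
  have hH2 : ContDiff ℝ 2 h := hfun ▸ contDiff_screwField_centre κ c
  have hUd : ∀ y, DifferentiableAt ℝ (u t) y := fun y => (hU2.differentiable (by norm_num)) y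
  have hHd : ∀ y, DifferentiableAt ℝ h y := fun y => (hH2.differentiable (by norm_num)) y
  have hDh : ∀ y w, fderiv ℝ h y w = κ • rotGen w := fun y w => by
    rw [hfun, (hasFDerivAt_screwField_centre κ c y).fderiv]; rfl
  -- ## (T) the time derivative
  have hdu : HasDerivWithinAt (fun τ => u τ x) (timeDerivWithin S u t x) S t := by
    rw [timeDerivWithin_apply]
    exact (hns.smooth_velocity.differentiableWithinAt_time ht x).hasDerivWithinAt
  have hT : derivWithin (fun τ => ⟪u τ x, h x⟫_ℝ) S t = ⟪timeDerivWithin S u t x, h x⟫_ℝ := by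
    have h1 := (hdu.inner ℝ (hasDerivWithinAt_const t S (h x))).derivWithin (hS t ht)
    simpa only [inner_zero_right, zero_add] using h1
  -- ## (X) the convective derivative: `⟪u, (u·∇)h⟫ = κ⟪u, Ju⟫ = 0`
  have hX : fderiv ℝ (fun y => ⟪u t y, h y⟫_ℝ) x (u t x) = ⟪fderiv ℝ (u t) x (u t x), h x⟫_ℝ := by
    rw [fderiv_inner_apply ℝ (hUd x) (hHd x) (u t x), hDh, inner_smul_right, real_inner_comm,
      inner_rotGen_self, mul_zero, zero_add]
  -- ## (L) the Laplacian: `Δ(u·h) = ⟪Δu, h⟫ + 2κ ω₃`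
  have hL : (Δ (fun y => ⟪u t y, h y⟫_ℝ)) x = ⟪(Δ (u t)) x, h x⟫_ℝ + 2 * κ * curl (u t) x 2 := by
    rw [laplacian_inner_eq (EuclideanSpace.basisFun (Fin 3) ℝ) hU2 hH2 x, hfun, laplacian_screwField_centre,
      inner_zero_right, add_zero, ← hfun]
    have hsum : ∑ i, ⟪fderiv ℝ (u t) x (EuclideanSpace.basisFun (Fin 3) ℝ i),
        fderiv ℝ h x (EuclideanSpace.basisFun (Fin 3) ℝ i)⟫_ℝ = κ * curl (u t) x 2 := by
      simp_rw [hDh, inner_smul_right, ← Finset.mul_sum]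
      rw [sum_inner_fderiv_rotGen_eq_curl_two]
    rw [hsum]; ring
  -- ## (M) the momentum equation against `h`
  have hM : ⟪timeDerivWithin S u t x, h x⟫_ℝ + ⟪fderiv ℝ (u t) x (u t x), h x⟫_ℝ =
      ν * ⟪(Δ (u t)) x, h x⟫_ℝ - ⟪gradient (p t) x, h x⟫_ℝ := by
    have h1 := congrArg (fun z => ⟪z, h x⟫_ℝ) (hns.momentum t ht x)
    simpa only [convect_apply, Pi.zero_apply, add_zero, inner_add_left, inner_sub_left, real_inner_smul_left]
      using h1
  rw [hT, hX, hL]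
  linear_combination hM

variable {C : ℝ} {v : ℝ → EuclideanSpace ℝ (Fin 3) → EuclideanSpace ℝ (Fin 3)}

/-- **The screw component of a POLOIDAL profile of the route's Type-I class, general axis.**  For every window
`(t₀, 0)`, `t₀ < 0`, there is a classical pressure `p` with `(∂ₜ + v·∇ − Δ)(v·h) = −h·∇p` pointwise on the window,
`h = e₃ + κ J(· − c)` (port of `…Screw.screwComponent_transport_of_class`, `c = 0`). -/
theorem screwComponent_transport_of_class_centre (hrate : HasTypeITimeDecay C v)
    (hcont : ContinuousOn (uncurry v) (Iio (0 : ℝ) ×ˢ univ))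
    (hmild : ∀ s t : ℝ, s < t → t < 0 → ∀ x,
      v t x = UnboundedOperators.heatExtension (v s) (t - s) x - oseenDuhamel 1 s v v t x)
    (hdiv : ∀ t < 0, VectorCalculus.IsDivFree (v t))
    (hpol : ∀ s < 0, ∀ y, ⟪curl (v s) y, EuclideanSpace.single 2 (1 : ℝ)⟫_ℝ = 0)
    (κ : ℝ) (c : EuclideanSpace ℝ (Fin 3)) {t₀ : ℝ} (ht₀ : t₀ < 0) :
    ∃ p : ℝ → EuclideanSpace ℝ (Fin 3) → ℝ, IsClassicalNSSolutionOn (Ioo t₀ 0) 1 0 v p ∧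
      ∀ s ∈ Ioo t₀ 0, ∀ x,
        derivWithin (fun τ => ⟪v τ x, (EuclideanSpace.single 2 (1 : ℝ) : EuclideanSpace ℝ (Fin 3)) + κ • rotGen (x - c)⟫_ℝ) (Ioo t₀ 0) s
            + fderiv ℝ (fun y => ⟪v s y, (EuclideanSpace.single 2 (1 : ℝ) : EuclideanSpace ℝ (Fin 3)) + κ • rotGen (y - c)⟫_ℝ) x (v s x)
            - (Δ (fun y => ⟪v s y, (EuclideanSpace.single 2 (1 : ℝ) : EuclideanSpace ℝ (Fin 3)) + κ • rotGen (y - c)⟫_ℝ)) x =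
          -⟪gradient (p s) x, (EuclideanSpace.single 2 (1 : ℝ) : EuclideanSpace ℝ (Fin 3)) + κ • rotGen (x - c)⟫_ℝ := by
  obtain ⟨p, hns⟩ := (isTypeIAncientMild_of_class hrate hcont hmild hdiv).exists_isClassicalNSSolutionOn_Ioo ht₀
  refine ⟨p, hns, fun s hs x => ?_⟩
  have hω : curl (v s) x 2 = 0 := by
    have h1 := hpol s hs.2 x
    rwa [EuclideanSpace.inner_single_right, one_mul, conj_trivial] at h1
  have h2 := screwComponent_transport_centre κ c isOpen_Ioo hns
    (h := fun y => (EuclideanSpace.single 2 (1 : ℝ) : EuclideanSpace ℝ (Fin 3)) + κ • rotGen (y - c))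
    (fun _ => rfl) hs x
  rw [hω, mul_zero, sub_zero, one_mul] at h2
  exact h2

/-! ### L4's inputs for `θ = v·h`: joint regularity, the equation (from L3), the slope (from L2), the rate -/

/-- **`θ(t,y) = ⟪v t y, h y⟫` is jointly `C²` on the open slab** (the class is jointly `C^∞` there, `h` is affine). -/
theorem contDiffOn_screwComponent (hrate : HasTypeITimeDecay C v)
    (hcont : ContinuousOn (uncurry v) (Iio (0 : ℝ) ×ˢ univ))
    (hmild : ∀ s t : ℝ, s < t → t < 0 → ∀ x,
      v t x = UnboundedOperators.heatExtension (v s) (t - s) x - oseenDuhamel 1 s v v t x)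
    (hdiv : ∀ t < 0, VectorCalculus.IsDivFree (v t)) (κ : ℝ) (c : EuclideanSpace ℝ (Fin 3)) :
    ContDiffOn ℝ 2 (uncurry fun (t : ℝ) (y : EuclideanSpace ℝ (Fin 3)) =>
      ⟪v t y, (EuclideanSpace.single 2 (1 : ℝ) : EuclideanSpace ℝ (Fin 3)) + κ • rotGen (y - c)⟫_ℝ) (Iio (0 : ℝ) ×ˢ univ) := by
  have hA : IsTypeIAncientMild C v := isTypeIAncientMild_of_class hrate hcont hmild hdiv
  have h1 : ContDiffOn ℝ 2 (uncurry v) (Iio (0 : ℝ) ×ˢ univ) := contDiffOn_infty.1 hA.contDiffOn 2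
  have h2 : ContDiffOn ℝ 2 (fun q : ℝ × EuclideanSpace ℝ (Fin 3) =>
      (EuclideanSpace.single 2 (1 : ℝ) : EuclideanSpace ℝ (Fin 3)) + κ • rotGen (q.2 - c)) (Iio (0 : ℝ) ×ˢ univ) :=
    ((contDiff_screwField_centre κ c).comp contDiff_snd).contDiffOn
  exact h1.inner ℝ h2

end Summit.NavierStokesRegularity.NavierStokesRegularity.Theorems.PoloidalWindowDoorPoloidalWindowRigidityScrewGlue

end
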